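import Literature.Analysis.FunctionSpaces.PoissonMeckeCylinders
import Mathlib.MeasureTheory.Constructions.BorelSpace.Complex
import Mathlib.Topology.MetricSpace.ProperSpace
import Mathlib.Analysis.Complex.Basic
import HarnessLib

/-!
# Countable generators of the count σ-algebra on point configurations

(topic Analysis/FunctionSpaces, next to `PoissonPointProcess` / `PoissonMeckeCylinders`; no new
definitions, no new named facts.)

The σ-algebra on locally finite simple configurations `PointConfig E`
(`PointConfig.instMeasurableSpace`, Kingman 1993, §2.1; Last–Penrose 2017, §2.1, the σ-field `𝒩`)
is generated by *all* counting maps `c ↦ N_c(s)`, `s` measurable. For martingale arguments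
(Lévy's upward theorem along the `ℕ`-indexed filtration `σ(N(s₁), …, N(sₙ))`) one needs a
**sequence** of sets whose counts generate the count σ-algebra. This file proves the underlying
deterministic Dynkin-class statement and produces such countable families.

## Main results (all proved)

* `PointConfig.measurableSpace_eq_iSup_comap_count_of_generateFrom` — **generating π-systems
  suffice**: if `𝒮` is a π-system generating the σ-algebra of `E` which contains a monotone
  sequence `S n ↑ E` on whose members every configuration has finitely many points (e.g. each
  `S n` relatively compact), then the count σ-algebra is already generated by the counting maps
  `N(s)`, `s ∈ 𝒮`. Proof (Dynkin): fix `n`; the class of measurable `t` with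
  `N(t ∩ S n)` measurable for `σ(N(s), s ∈ 𝒮)` contains `𝒮` (π-system), is closed under
  complements inside `S n` (`N(S n ∖ t) = N(S n) - N(t ∩ S n)`, finite counts on `S n`) and under
  countable disjoint unions (finite additivity and a monotone limit), hence is everything
  (`MeasurableSpace.induction_on_inter`); finally `{N(t) = k} = ⋃ₙ ⋂_{m ≥ n} {N(t ∩ S m) = k}`.
  (Cf. Last–Penrose 2017, Exercise 2.2, the distributional form; Kallenberg, *Random Measures*
  (2017), Lemma 1.4, for counting measures and a dissecting semiring.)
* `PointConfig.measurable_iff_count_of_generateFrom` — the same as a measurability criterion for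
  maps into configurations.
* `exists_countable_isPiSystem_isBounded_generateFrom` — on a proper pseudometric space, the
  balls `B(x₀, n+1)` cut by finitely many members of a countable topological basis form a countable
  π-system of bounded open sets generating the Borel σ-algebra.
* `PointConfig.exists_countable_count_generators`, `…_complex` — hence on a proper metric Borel
  space, in particular on `ℂ`, there is a **countable π-system of bounded Borel sets whose counts
  generate the count σ-algebra**.

Auxiliary: counts along a monotone union (`PointConfig.count_iUnion_eq_natCast_iff`,
`PointConfig.count_iUnion_of_monotone`: `N(⋃ₙ tₙ) = ⨆ₙ N(tₙ)`) and the resulting measurability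
of `N(⋃ₙ tₙ)` for an arbitrary σ-algebra on configurations
(`PointConfig.measurable_count_iUnion_of_monotone`; `ℕ∞` carries the discrete σ-algebra, so
measurability of an `ℕ∞`-valued map is checked on the fibres over `ℕ`, `ENat.measurable_iff`).

## Not here

The martingale / discretisation layer of the Harris–FKG inequality for Poisson functionals
(Last–Penrose 2017, Thm. 20.4) for which this is a prerequisite.

## References

* J. F. C. Kingman, *Poisson Processes*, Oxford University Press (1993), §2.1.
  [cite: Kingman1993, §2.1]
* G. Last, M. Penrose, *Lectures on the Poisson Process*, Cambridge University Press (2017), §2.1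
  (the σ-field `𝒩(𝕏)`), Exercise 2.2. [cite: LastPenrose2017, §2.1]
* O. Kallenberg, *Random Measures, Theory and Applications*, Springer (2017), Lemma 1.4.
-/

open MeasureTheory Set TopologicalSpace
open scoped ENNReal

namespace Literature.Analysis.FunctionSpaces

namespace PointConfig

variable {E : Type*} [TopologicalSpace E]

/-! ## Counts along a monotone union -/

/-- A configuration has no points in the empty set: `N_c(∅) = 0`. [folklore] -/
@[simp] theorem count_emptyset (c : PointConfig E) : c.count (∅ : Set E) = 0 := by
  simp [count]

/-- **Counts along a monotone union, fibrewise**: for a monotone sequence of sets `tₙ` and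
`k ∈ ℕ`, `N_c(⋃ₙ tₙ) = k` iff `N_c(t_m) = k` for all large `m` (a finite set of points of the
union lies in some `tₙ`; `count_eq_natCast_iff_eventually` for the exhaustion `t_m ∪ (⋃ₙ tₙ)ᶜ`).
[folklore] -/
theorem count_iUnion_eq_natCast_iff (c : PointConfig E) {t : ℕ → Set E} (hmono : Monotone t)
    (k : ℕ) : c.count (⋃ n, t n) = k ↔ ∃ n, ∀ m, n ≤ m → c.count (t m) = k := by
  have hSmono : Monotone fun m => t m ∪ (⋃ n, t n)ᶜ := fun a b hab =>
    union_subset_union_left _ (hmono hab)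
  have hSU : (⋃ m, (t m ∪ (⋃ n, t n)ᶜ)) = univ := by
    rw [iUnion_union_distrib, iUnion_const, union_compl_self]
  have hinter : ∀ m, (⋃ n, t n) ∩ (t m ∪ (⋃ n, t n)ᶜ) = t m := fun m => by
    rw [inter_union_distrib_left, inter_compl_self, union_empty,
      inter_eq_right.2 (subset_iUnion t m)]
  simpa only [hinter] using c.count_eq_natCast_iff_eventually (⋃ n, t n) hSmono hSU k

/-- **Counts along a monotone union**: `N_c(⋃ₙ tₙ) = ⨆ₙ N_c(tₙ)` for a monotone sequence `tₙ`
(continuity from below of the counting function; a finite set of points of the union lies in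
some `tₙ`). [folklore] -/
theorem count_iUnion_of_monotone (c : PointConfig E) {t : ℕ → Set E} (hmono : Monotone t) :
    c.count (⋃ n, t n) = ⨆ n, c.count (t n) := by
  refine le_antisymm ?_ (iSup_le fun n => c.count_mono (subset_iUnion t n))
  refine ENat.forall_natCast_le_iff_le.1 fun a ha => ?_
  obtain ⟨u, hu, hua⟩ := Set.exists_subset_encard_eq ha
  have hufin : u.Finite := Set.finite_of_encard_eq_coe hua
  obtain ⟨I, hI, huI⟩ := Set.finite_subset_iUnion hufin (t := t) fun x hx => (hu hx).2
  obtain ⟨N, hN⟩ := hI.bddAbove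
  have huN : u ⊆ c.carrier ∩ t N := fun x hx => by
    obtain ⟨i, hi, hxi⟩ := mem_iUnion₂.1 (huI hx)
    exact ⟨(hu hx).1, hmono (hN hi) hxi⟩
  calc (a : ℕ∞) = u.encard := hua.symm
    _ ≤ c.count (t N) := Set.encard_le_encard huN
    _ ≤ ⨆ n, c.count (t n) := le_iSup (fun n => c.count (t n)) N

/-- **Measurability of the count of a monotone union**, for an arbitrary σ-algebra `m` on
configurations: if all `c ↦ N_c(tₙ)` are `m`-measurable and `tₙ` is monotone, so is
`c ↦ N_c(⋃ₙ tₙ)` (its fibre over `k ∈ ℕ` is `⋃ₙ ⋂_{m ≥ n} {N(t_m) = k}`, and an `ℕ∞`-valued map is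
measurable once its fibres over `ℕ` are, `ENat.measurable_iff`). [folklore] -/
theorem measurable_count_iUnion_of_monotone {m : MeasurableSpace (PointConfig E)} {t : ℕ → Set E}
    (hmono : Monotone t) (h : ∀ n, Measurable[m] fun c : PointConfig E => c.count (t n)) :
    Measurable[m] fun c : PointConfig E => c.count (⋃ n, t n) := by
  refine ENat.measurable_iff.2 fun k => ?_
  have hset : (fun c : PointConfig E => c.count (⋃ n, t n)) ⁻¹' {(k : ℕ∞)} =
      ⋃ n, ⋂ m', ⋂ (_ : n ≤ m'), (fun c : PointConfig E => c.count (t m')) ⁻¹' {(k : ℕ∞)} := by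
    ext c
    simp only [mem_preimage, mem_singleton_iff, mem_iUnion, mem_iInter]
    exact c.count_iUnion_eq_natCast_iff hmono k
  rw [hset]
  exact MeasurableSet.iUnion fun n => MeasurableSet.iInter fun m' =>
    MeasurableSet.iInter fun _ => h m' (measurableSet_singleton _)

/-! ## Generating π-systems generate the count σ-algebra -/

variable [MeasurableSpace E]

/-- **A generating π-system of `E` generates the count σ-algebra (Dynkin argument).** Let `𝒮` be
a π-system generating the σ-algebra of `E` and containing a monotone sequence `S n ↑ E` such that
every configuration has finitely many points in each `S n` (e.g. `S n` contained in a compact set,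
`PointConfig.count_lt_top_of_isCompact`). Then the count σ-algebra
`PointConfig.instMeasurableSpace = σ(N(s), s measurable)` is generated by the counting maps of the
members of `𝒮` alone: `σ(N(s), s ∈ 𝒮) = σ(N(s), s measurable)`.

Proof: `≤` is `measurable_count`. For `≥`, fix `n`; by `MeasurableSpace.induction_on_inter` the
class of measurable `t` with `c ↦ N_c(t ∩ S n)` measurable for `σ(N(s), s ∈ 𝒮)` is everything: it
contains `∅` and `𝒮` (`t ∩ S n ∈ 𝒮` or `= ∅`), is closed under complement
(`N(tᶜ ∩ S n) = N(S n) - N(t ∩ S n)` as `N(S n) < ∞`; subtraction on the discrete space `ℕ∞` is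
measurable) and under countable disjoint unions (finite additivity `count_biUnion_finset` and
`measurable_count_iUnion_of_monotone`). Finally `N(t) = N(⋃ₙ t ∩ S n)` is measurable by
`measurable_count_iUnion_of_monotone` again. (Kingman 1993, §2.1 and Last–Penrose 2017, §2.1 for
the σ-algebra; cf. Last–Penrose 2017, Exercise 2.2, and Kallenberg 2017, Lemma 1.4.) [folklore] -/
theorem measurableSpace_eq_iSup_comap_count_of_generateFrom {𝒮 : Set (Set E)}
    (hπ : IsPiSystem 𝒮) (hgen : MeasurableSpace.generateFrom 𝒮 = ‹MeasurableSpace E›)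
    {S : ℕ → Set E} (hS : ∀ n, S n ∈ 𝒮) (hmono : Monotone S) (hU : ⋃ n, S n = univ)
    (hfin : ∀ (c : PointConfig E) (n : ℕ), c.count (S n) < ⊤) :
    (⨆ s ∈ 𝒮, (⊤ : MeasurableSpace ℕ∞).comap fun c : PointConfig E => c.count s) =
      (PointConfig.instMeasurableSpace : MeasurableSpace (PointConfig E)) := by
  have hmeas : ∀ s ∈ 𝒮, MeasurableSet s := fun s hs => by
    rw [← hgen]
    exact MeasurableSpace.measurableSet_generateFrom hs
  apply le_antisymm
  · exact iSup₂_le fun s hs => (measurable_count (hmeas s hs)).comap_le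
  · -- the σ-algebra generated by the counts of the members of `𝒮`
    set m𝒮 : MeasurableSpace (PointConfig E) :=
      ⨆ s ∈ 𝒮, (⊤ : MeasurableSpace ℕ∞).comap fun c : PointConfig E => c.count s
    have hbasic : ∀ s ∈ 𝒮, Measurable[m𝒮] fun c : PointConfig E => c.count s := fun s hs => by
      rw [measurable_iff_comap_le]
      exact le_iSup₂ (f := fun (s : Set E) (_ : s ∈ 𝒮) =>
        (⊤ : MeasurableSpace ℕ∞).comap fun c : PointConfig E => c.count s) s hs
    -- Dynkin: for every `n` and every measurable `t`, `N(t ∩ S n)` is `m𝒮`-measurable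
    have hdyn : ∀ (n : ℕ) (t : Set E), MeasurableSet t →
        Measurable[m𝒮] fun c : PointConfig E => c.count (t ∩ S n) := by
      intro n
      refine MeasurableSpace.induction_on_inter
        (C := fun t _ => Measurable[m𝒮] fun c : PointConfig E => c.count (t ∩ S n))
        hgen.symm hπ ?_ ?_ ?_ ?_
      · simp only [empty_inter, count_emptyset]
        exact measurable_const
      · intro t ht
        rcases (t ∩ S n).eq_empty_or_nonempty with h | h
        · simp only [h, count_emptyset]
          exact measurable_const
        · exact hbasic _ (hπ t ht (S n) (hS n) h)
      · intro t _ ih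
        have heq : (fun c : PointConfig E => c.count (tᶜ ∩ S n)) =
            fun c => c.count (S n) - c.count (t ∩ S n) := by
          funext c
          have hsplit : c.count (S n) = c.count (t ∩ S n) + c.count (tᶜ ∩ S n) := by
            rw [← count_union_of_disjoint c
                (disjoint_compl_right.mono inter_subset_left inter_subset_left),
              ← union_inter_distrib_right, union_compl_self, univ_inter]
          have hne : c.count (t ∩ S n) ≠ ⊤ :=
            ne_top_of_le_ne_top (hfin c n).ne (c.count_mono inter_subset_right)
          rw [hsplit, (ENat.addLECancellable_of_ne_top hne).add_tsub_cancel_left]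
        rw [heq]
        exact (hbasic _ (hS n)).sub ih
      · intro f hdisj _ ih
        have hset : (⋃ i, f i) ∩ S n = ⋃ M : ℕ, ⋃ i ∈ Finset.range M, f i ∩ S n := by
          ext x
          simp only [mem_inter_iff, mem_iUnion, Finset.mem_range, exists_prop]
          constructor
          · rintro ⟨⟨i, hi⟩, hx⟩
            exact ⟨i + 1, i, Nat.lt_succ_self i, hi, hx⟩
          · rintro ⟨-, i, -, hi, hx⟩
            exact ⟨⟨i, hi⟩, hx⟩
        have heq : (fun c : PointConfig E => c.count ((⋃ i, f i) ∩ S n)) =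
            fun c => c.count (⋃ M : ℕ, ⋃ i ∈ Finset.range M, f i ∩ S n) := by
          funext c
          rw [hset]
        rw [heq]
        refine measurable_count_iUnion_of_monotone (fun a b hab => ?_) fun M => ?_
        · refine Set.biUnion_subset_biUnion_left fun i hi => ?_
          simp only [Finset.coe_range, mem_Iio] at hi ⊢
          omega
        · have hsum : (fun c : PointConfig E => c.count (⋃ i ∈ Finset.range M, f i ∩ S n)) =
              fun c => ∑ i ∈ Finset.range M, c.count (f i ∩ S n) := by
            funext c
            exact count_biUnion_finset c _ _ fun i _ j _ hij =>
              (hdisj hij).mono inter_subset_left inter_subset_left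
          rw [hsum]
          exact Finset.measurable_sum _ fun i _ => ih i
    -- every counting map `N(t) = N(⋃ₙ t ∩ S n)` is `m𝒮`-measurable
    refine iSup₂_le fun t ht => ?_
    rw [← measurable_iff_comap_le]
    have heq : (fun c : PointConfig E => c.count t) = fun c => c.count (⋃ n, t ∩ S n) := by
      rw [← inter_iUnion, hU, inter_univ]
    rw [heq]
    exact measurable_count_iUnion_of_monotone
      (fun a b hab => inter_subset_inter_right _ (hmono hab)) fun n => hdyn n t ht

/-- **Measurability into configurations is checked on a generating π-system**: under the
hypotheses of `measurableSpace_eq_iSup_comap_count_of_generateFrom`, a map `f` into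
configurations is measurable iff all the counting maps `a ↦ N_{f a}(s)`, `s ∈ 𝒮`, are
(universal property of `σ(N(s), s ∈ 𝒮)`; Kingman 1993, §2.1). [folklore] -/
theorem measurable_iff_count_of_generateFrom {𝒮 : Set (Set E)}
    (hπ : IsPiSystem 𝒮) (hgen : MeasurableSpace.generateFrom 𝒮 = ‹MeasurableSpace E›)
    {S : ℕ → Set E} (hS : ∀ n, S n ∈ 𝒮) (hmono : Monotone S) (hU : ⋃ n, S n = univ)
    (hfin : ∀ (c : PointConfig E) (n : ℕ), c.count (S n) < ⊤)
    {α : Type*} [MeasurableSpace α] {f : α → PointConfig E} :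
    Measurable f ↔ ∀ s ∈ 𝒮, Measurable fun a => (f a).count s := by
  have hmeas : ∀ s ∈ 𝒮, MeasurableSet s := fun s hs => by
    rw [← hgen]
    exact MeasurableSpace.measurableSet_generateFrom hs
  refine ⟨fun hf s hs => (measurable_count (hmeas s hs)).comp hf, fun hf => ?_⟩
  rw [measurable_iff_comap_le,
    ← measurableSpace_eq_iSup_comap_count_of_generateFrom hπ hgen hS hmono hU hfin]
  simp only [MeasurableSpace.comap_iSup, MeasurableSpace.comap_comp]
  exact iSup₂_le fun s hs => (hf s hs).comap_le

end PointConfig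

/-! ## Countable π-systems of bounded sets on proper metric spaces; the case of `ℂ` -/

section ProperSpace

variable {X : Type*} [PseudoMetricSpace X] [ProperSpace X] [MeasurableSpace X] [BorelSpace X]

open Metric in
/-- **A countable generating π-system of bounded open sets.** On a proper pseudometric space with
its Borel σ-algebra and a base point `x₀`, the sets `B(x₀, n+1) ∩ U₁ ∩ ⋯ ∩ U_k` (`n ∈ ℕ`, `Uᵢ` in a
fixed countable topological basis, `k ≥ 0`) form a countable π-system of bounded open sets which
generates the Borel σ-algebra (every basic open `U = ⋃ₙ B(x₀, n+1) ∩ U`) and contains the balls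
`B(x₀, n+1)`. [folklore] -/
theorem exists_countable_isPiSystem_isBounded_generateFrom (x₀ : X) :
    ∃ 𝒮 : Set (Set X), 𝒮.Countable ∧ (∀ s ∈ 𝒮, IsOpen s ∧ Bornology.IsBounded s) ∧
      IsPiSystem 𝒮 ∧ MeasurableSpace.generateFrom 𝒮 = ‹MeasurableSpace X› ∧
      ∀ n : ℕ, ball x₀ (n + 1) ∈ 𝒮 := by
  classical
  obtain ⟨b, hbc, -, hb⟩ := TopologicalSpace.exists_countable_basis X
  haveI : Countable b := hbc.to_subtype
  -- the family, indexed by the countable type `ℕ × Finset b`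
  let g : ℕ × Finset b → Set X := fun p => ball x₀ (p.1 + 1) ∩ ⋂ s ∈ p.2, (s : Set X)
  have hopen : ∀ p, IsOpen (g p) := fun p =>
    isOpen_ball.inter (isOpen_biInter_finset fun s _ => hb.isOpen s.2)
  have hball : ∀ n : ℕ, g (n, ∅) = ball x₀ (n + 1) := fun n => by simp [g]
  have hbasic : ∀ (s : Set X) (hs : s ∈ b), s = ⋃ n : ℕ, g (n, {⟨s, hs⟩}) := fun s hs => by
    simp only [g, Finset.mem_singleton, iInter_iInter_eq_left]
    rw [← iUnion_inter, iUnion_ball_nat_succ, univ_inter]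
  have hinter : ∀ p q, g p ∩ g q = g (min p.1 q.1, p.2 ∪ q.2) := fun p q => by
    ext y
    simp only [g, mem_inter_iff, mem_ball, mem_iInter, Finset.mem_union, Nat.cast_min,
      ← min_add_add_right, lt_min_iff]
    constructor
    · rintro ⟨⟨h1, h3⟩, ⟨h2, h4⟩⟩
      exact ⟨⟨h1, h2⟩, fun s hs => hs.elim (h3 s) (h4 s)⟩
    · rintro ⟨⟨h1, h2⟩, h3⟩
      exact ⟨⟨h1, fun s hs => h3 s (Or.inl hs)⟩, ⟨h2, fun s hs => h3 s (Or.inr hs)⟩⟩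
  refine ⟨Set.range g, Set.countable_range g, ?_, ?_, ?_, fun n => ⟨(n, ∅), hball n⟩⟩
  · rintro _ ⟨p, rfl⟩
    exact ⟨hopen p, isBounded_ball.subset inter_subset_left⟩
  · rintro _ ⟨p, rfl⟩ _ ⟨q, rfl⟩ -
    exact ⟨(min p.1 q.1, p.2 ∪ q.2), (hinter p q).symm⟩
  · apply le_antisymm
    · exact MeasurableSpace.generateFrom_le (by rintro _ ⟨p, rfl⟩; exact (hopen p).measurableSet)
    · rw [BorelSpace.measurable_eq (α := X), hb.borel_eq_generateFrom]
      refine MeasurableSpace.generateFrom_le fun s hs => ?_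
      rw [hbasic s hs]
      exact MeasurableSet.iUnion fun n =>
        MeasurableSpace.measurableSet_generateFrom (Set.mem_range_self _)

open Metric in
/-- **Countable count generators on a proper metric space.** On a nonempty proper pseudometric
space with its Borel σ-algebra there is a countable π-system `𝒮` of bounded Borel sets whose
counting maps generate the count σ-algebra of configurations:
`σ(N(s), s ∈ 𝒮) = PointConfig.instMeasurableSpace` (the family of
`exists_countable_isPiSystem_isBounded_generateFrom` fed into
`PointConfig.measurableSpace_eq_iSup_comap_count_of_generateFrom` with the exhaustion by the
relatively compact balls `B(x₀, n+1)`). [folklore] -/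
theorem PointConfig.exists_countable_count_generators [Nonempty X] :
    ∃ 𝒮 : Set (Set X), 𝒮.Countable ∧ (∀ s ∈ 𝒮, MeasurableSet s ∧ Bornology.IsBounded s) ∧
      IsPiSystem 𝒮 ∧
      (⨆ s ∈ 𝒮, (⊤ : MeasurableSpace ℕ∞).comap fun c : PointConfig X => c.count s) =
        (PointConfig.instMeasurableSpace : MeasurableSpace (PointConfig X)) := by
  obtain ⟨x₀⟩ := ‹Nonempty X›
  obtain ⟨𝒮, hc, hob, hπ, hgen, hball⟩ := exists_countable_isPiSystem_isBounded_generateFrom x₀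
  refine ⟨𝒮, hc, fun s hs => ⟨(hob s hs).1.measurableSet, (hob s hs).2⟩, hπ, ?_⟩
  exact PointConfig.measurableSpace_eq_iSup_comap_count_of_generateFrom hπ hgen hball
    (fun a b hab => ball_subset_ball (by exact_mod_cast Nat.add_le_add_right hab 1))
    (iUnion_ball_nat_succ x₀)
    fun c n => (c.count_mono ball_subset_closedBall).trans_lt
      (c.count_lt_top_of_isCompact (isCompact_closedBall x₀ _))

end ProperSpace

/-- **Countable count generators on `ℂ`.** There is a countable π-system of bounded Borel subsets
of `ℂ` (balls `B(z₀, n+1)` around a base point cut by finitely many basic open sets) whose counting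
maps generate the count σ-algebra of locally finite configurations in the plane — the input for
martingale (Lévy upward) arguments along count filtrations of planar Poisson functionals.
[folklore] -/
theorem PointConfig.exists_countable_count_generators_complex :
    ∃ 𝒮 : Set (Set ℂ), 𝒮.Countable ∧ (∀ s ∈ 𝒮, MeasurableSet s ∧ Bornology.IsBounded s) ∧
      IsPiSystem 𝒮 ∧
      (⨆ s ∈ 𝒮, (⊤ : MeasurableSpace ℕ∞).comap fun c : PointConfig ℂ => c.count s) =
        (PointConfig.instMeasurableSpace : MeasurableSpace (PointConfig ℂ)) :=
  PointConfig.exists_countable_count_generators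

end Literature.Analysis.FunctionSpaces
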